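import Summits.CriticalPhenomena.PercolationContinuityZ3.Theorems.Transplant.FKConnectivityAllQK5CellsDefs
import Summits.CriticalPhenomena.PercolationContinuityZ3.Theorems.Transplant.FKConnectivityAllQHubCovFiberPoly
import Summits.CriticalPhenomena.PercolationContinuityZ3.Theorems.Transplant.FKConnectivityAllQBernsteinCriterion
import HarnessLib

/-!
# Connectivity correlation inequalities for `φ_{w,q}`, every `q > 0` — the `K₅` KERNEL CERTIFICATE, file 2 (reflection):
# the fiber polynomials of `K₅ − {01, 02}` ARE `Σ_e cellCoeff e · q^e`, and `CellOK` makes them nonnegative on `[0,1]`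

Helper file (`--supports stmt-CriticalPhenomena-4575`), FK sub-lane `prim-bschramm-fk-3` (gen 10) of the post-continuity programme;
builds on p205010 (kernel theorem, internal audit signed; external expert review pending).  No definitions, no named facts, no sorries;
standard axioms.

File 1 (`…K5CellsDefs`) lists the eight pairs `E₈ = {03, 04, 12, 13, 14, 23, 24, 34}` of `K₅` as `K5.listing : FK.RCEval` and defines,
from a packed table of cluster counts and connection bits, the integer coefficients `K5.cellCoeff I J e` and the Bernstein test
`K5.CellOK I J`.  Here:
* `K5.table_spec` (`decide`): the table agrees with gen 5's computable `kB` / `reachB` on all `2^8` configurations — so by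
  `RCEval.clusterCount_conf` / `RCEval.reachB_iff` it gives the true cluster count `k(conf t)` and the events `0↔1`, `0↔2`, `1↔2`;
* `K5.pairTerm_eq`: the summand of fk-1 g6's fiber polynomial at the pair `(conf t₁, conf t₂)` (hub triple `(0; 1, 2)`) is
  `sig0·q^{k₁+k₂} + sig1·q^{k₁+k₂+1}` with the table signs of file 1;
* **`K5.powersetSum_eq_sum_cellCoeff`**: the fiber polynomial of `(conf I, conf J)` — the powerset sum of
  `RCEval.hubCovBoundUnder_of_listed` (`…HubCovFiberPoly`) — equals `Σ_{e < 12} cellCoeff I J e · q^e`;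
* **`K5.powersetSum_nonneg_of_cellOK`**: `CellOK I J` ⇒ the fiber polynomial is `≥ 0` on `[0,1]` (gen 9's Bernstein criterion
  `FK.sum_mul_pow_nonneg_of_bernstein`, degree 11);
* **`K5.hubCovBoundUnder_012_of_cellOK`**: if `CellOK I J` for all `I ⊆ J ⊆ Fin 8`, then `HubCovBoundUnder (φ_{U,q}) q 0 1 2` for every
  `0 < q ≤ 1` and every weight vector `U` on `Fin 5` supported in `E₈`;
* bookkeeping for the assembly: `ofMask_maskOf`, `maskOf_lt`, `exists_edge_eq` (every non-loop pair `≠ 01, 02` is listed).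
The `decide` over all `6561` fibers is in the files `…K5CellsDecide*`; the assembly (pinning, loops, transport) in `…K5`.
[cite: Grimmett2006, §1.4 eq. (1.20) (p. 15); §3.9 eq. (3.94) (pp. 63–64)] [cite: Wagner2006, Conj. 5.3, Ex. 5.1–5.2 (p. 13)]
-/

namespace Summit.CriticalPhenomena.PercolationContinuityZ3.Theorems

namespace FK

namespace K5

open MeasureTheory Finset Literature.Probability.LatticeModels Literature.Probability.Percolation
open Literature.Probability.Percolation.DecisionTree (ind ind_of_mem ind_of_not_mem)
open scoped Classical

/-! ### The table is correct (kernel check against `kB` / `reachB`) -/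

/-- The listing is valid (pairs distinct). [folklore] -/
theorem listing_valid : listing.Valid := by decide +kernel

/-- **The packed table is correct**: for every configuration `t ⊆ E₈`, the table's cluster count is `kB t` and its three bits are
`reachB t 0 1`, `reachB t 0 2`, `reachB t 1 2` (`2^8` kernel evaluations of gen 5's computable side). [cite: Grimmett2006, §1.2 eq. (1.1) (p. 4)] -/
theorem table_spec : ∀ t : Finset (Fin 8), listing.kB t = kOf (maskOf t) ∧ listing.reachB t 0 1 = r01 (maskOf t) ∧
    listing.reachB t 0 2 = r02 (maskOf t) ∧ listing.reachB t 1 2 = r12 (maskOf t) := by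
  decide +kernel

/-- The table's cluster counts are at most `5`. [folklore] -/
theorem kOf_maskOf_le : ∀ t : Finset (Fin 8), kOf (maskOf t) ≤ 5 := by decide +kernel

/-- `ofMask` inverts `maskOf`. [folklore] -/
theorem ofMask_maskOf : ∀ t : Finset (Fin 8), ofMask (maskOf t) = t := by decide +kernel

/-- Masks of subsets of `Fin 8` are `< 256`. [folklore] -/
theorem maskOf_lt : ∀ t : Finset (Fin 8), maskOf t < 256 := by decide +kernel

/-- **Every non-loop pair of `Fin 5` other than `01, 02` is listed.** [folklore] -/
theorem exists_edge_eq : ∀ e : Sym2 (Fin 5), ¬ e.IsDiag → e ≠ s(0, 1) → e ≠ s(0, 2) → ∃ i : Fin 8, listing.edge i = e := by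
  decide +kernel

/-! ### Reading the events of the bound from the table -/

/-- The cluster count of `conf t` is the table's. [cite: Grimmett2006, §1.2 eq. (1.1) (p. 4)] -/
theorem clusterCount_conf_eq (t : Finset (Fin 8)) : clusterCount (listing.conf t) ∅ = kOf (maskOf t) := by
  rw [RCEval.clusterCount_conf, (table_spec t).1]

/-- `conf t ∈ {0 ↔ 1}` iff the table bit `r01`. [folklore] -/
theorem conf_mem_openConn01 (t : Finset (Fin 8)) :
    listing.conf t ∈ (openConn (0 : Fin 5) 1 : Set (BondConfig (Fin 5))) ↔ r01 (maskOf t) = true := by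
  rw [mem_openConn_iff', ← RCEval.reachB_iff, (table_spec t).2.1]

/-- `conf t ∈ {0 ↔ 2}` iff the table bit `r02`. [folklore] -/
theorem conf_mem_openConn02 (t : Finset (Fin 8)) :
    listing.conf t ∈ (openConn (0 : Fin 5) 2 : Set (BondConfig (Fin 5))) ↔ r02 (maskOf t) = true := by
  rw [mem_openConn_iff', ← RCEval.reachB_iff, (table_spec t).2.2.1]

/-- `conf t ∈ {1 ↔ 2}` iff the table bit `r12`. [folklore] -/
theorem conf_mem_openConn12 (t : Finset (Fin 8)) :
    listing.conf t ∈ (openConn (1 : Fin 5) 2 : Set (BondConfig (Fin 5))) ↔ r12 (maskOf t) = true := by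
  rw [mem_openConn_iff', ← RCEval.reachB_iff, (table_spec t).2.2.2]

/-! ### The summand of the fiber polynomial at a pair of listed configurations -/

/-- The sign bookkeeping of the fiber summand, over the six connection bits (`64` cases). [folklore] -/
theorem sign_identity (q : ℝ) (n : ℕ) (a₁ a₂ a₃ b₁ b₂ b₃ : Bool) :
    q ^ n * ((if (¬ a₁ = true ∧ a₃ = true) then (1 : ℝ) else 0) +
        (1 - q) * ((if (a₁ = true ∧ ¬ a₂ = true) then (1 : ℝ) else 0) * (if (¬ b₁ = true ∧ b₂ = true) then (1 : ℝ) else 0) -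
          (if (a₁ = true ∧ a₂ = true) then (1 : ℝ) else 0) *
            ((if (¬ b₁ = true ∧ b₃ = true) then (1 : ℝ) else 0) +
              (if ((¬ b₁ = true ∧ ¬ b₂ = true) ∧ ¬ b₃ = true) then (1 : ℝ) else 0)))) =
      ((toZ (!a₁ && a₃) + (toZ (a₁ && !a₂) * toZ (!b₁ && b₂) -
          toZ (a₁ && a₂) * (toZ (!b₁ && b₃) + toZ (!b₁ && !b₂ && !b₃))) : ℤ) : ℝ) * q ^ n +
        ((-(toZ (a₁ && !a₂) * toZ (!b₁ && b₂) - toZ (a₁ && a₂) * (toZ (!b₁ && b₃) + toZ (!b₁ && !b₂ && !b₃))) : ℤ) : ℝ) *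
          q ^ (n + 1) := by
  cases a₁ <;> cases a₂ <;> cases a₃ <;> cases b₁ <;> cases b₂ <;> cases b₃ <;> simp [toZ] <;> ring


/-- **The fiber summand from the table**: at the pair `(conf t₁, conf t₂)` and the hub triple `(0; 1, 2)`,
`q^{k₁+k₂}·(1_{x∤y~z}(ω₁) + (1−q)(1_{xy|z}(ω₁)1_{xz|y}(ω₂) − 1_{xyz}(ω₁)(1_{x∤y~z}(ω₂) + 1_{x|y|z}(ω₂))))
 = sig0·q^{k₁+k₂} + sig1·q^{k₁+k₂+1}`. [cite: Wagner2006, Conj. 5.3, Ex. 5.2 (p. 13)] -/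
theorem pairTerm_eq (q : ℝ) (t₁ t₂ : Finset (Fin 8)) :
    q ^ (clusterCount (listing.conf t₁) ∅ + clusterCount (listing.conf t₂) ∅) *
        (ind ((openConn (0 : Fin 5) 1 : Set (BondConfig (Fin 5)))ᶜ ∩ openConn 1 2) (listing.conf t₁) +
          (1 - q) * (ind (openConn (0 : Fin 5) 1 ∩ (openConn 0 2 : Set (BondConfig (Fin 5)))ᶜ) (listing.conf t₁) *
              ind ((openConn (0 : Fin 5) 1 : Set (BondConfig (Fin 5)))ᶜ ∩ openConn 0 2) (listing.conf t₂) -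
            ind (openConn (0 : Fin 5) 1 ∩ openConn 0 2) (listing.conf t₁) *
              (ind ((openConn (0 : Fin 5) 1 : Set (BondConfig (Fin 5)))ᶜ ∩ openConn 1 2) (listing.conf t₂) +
                ind ((openConn (0 : Fin 5) 1 : Set (BondConfig (Fin 5)))ᶜ ∩ (openConn 0 2 : Set (BondConfig (Fin 5)))ᶜ ∩
                  (openConn 1 2 : Set (BondConfig (Fin 5)))ᶜ) (listing.conf t₂)))) =
      (sig0 (maskOf t₁) (maskOf t₂) : ℝ) * q ^ (kOf (maskOf t₁) + kOf (maskOf t₂)) +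
        (sig1 (maskOf t₁) (maskOf t₂) : ℝ) * q ^ (kOf (maskOf t₁) + kOf (maskOf t₂) + 1) := by
  rw [clusterCount_conf_eq, clusterCount_conf_eq]
  simp only [DecisionTree.ind, Set.mem_inter_iff, Set.mem_compl_iff]
  rw [conf_mem_openConn01 t₁, conf_mem_openConn01 t₂, conf_mem_openConn02 t₁, conf_mem_openConn02 t₂,
    conf_mem_openConn12 t₁, conf_mem_openConn12 t₂]
  simp only [sig0, sig1, alpha, beta, bC, bT, bN, bA, bB]
  convert sign_identity q (kOf (maskOf t₁) + kOf (maskOf t₂)) (r01 (maskOf t₁)) (r02 (maskOf t₁)) (r12 (maskOf t₁))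
    (r01 (maskOf t₂)) (r02 (maskOf t₂)) (r12 (maskOf t₂))

/-! ### The fiber polynomial as `Σ_e cellCoeff e q^e` -/

/-- One summand regrouped by powers of `q`. [folklore] -/
theorem sum_range_ite_eq (q : ℝ) (a b : ℝ) {n : ℕ} (hn : n + 1 < 12) :
    ∑ e ∈ Finset.range 12, ((if n = e then a else 0) + (if n + 1 = e then b else 0)) * q ^ e =
      a * q ^ n + b * q ^ (n + 1) := by
  simp_rw [add_mul, Finset.sum_add_distrib, ite_mul, zero_mul, Finset.sum_ite_eq, Finset.mem_range]
  rw [if_pos (by omega), if_pos hn]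

/-- **The fiber polynomial of `(conf I, conf J)` is `Σ_{e < 12} cellCoeff I J e · q^e`** (hub triple `(0; 1, 2)`).
[cite: Wagner2006, Conj. 5.3, Ex. 5.2 (p. 13)] [cite: Grimmett2006, §1.4 eq. (1.20) (p. 15)] -/
theorem powersetSum_eq_sum_cellCoeff (q : ℝ) (I J : Finset (Fin 8)) :
    (∑ T ∈ (J \ I).powerset,
        q ^ (clusterCount (listing.conf (I ∪ T)) ∅ + clusterCount (listing.conf (J \ T)) ∅) *
          (ind ((openConn (0 : Fin 5) 1 : Set (BondConfig (Fin 5)))ᶜ ∩ openConn 1 2) (listing.conf (I ∪ T)) +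
            (1 - q) * (ind (openConn (0 : Fin 5) 1 ∩ (openConn 0 2 : Set (BondConfig (Fin 5)))ᶜ) (listing.conf (I ∪ T)) *
                ind ((openConn (0 : Fin 5) 1 : Set (BondConfig (Fin 5)))ᶜ ∩ openConn 0 2) (listing.conf (J \ T)) -
              ind (openConn (0 : Fin 5) 1 ∩ openConn 0 2) (listing.conf (I ∪ T)) *
                (ind ((openConn (0 : Fin 5) 1 : Set (BondConfig (Fin 5)))ᶜ ∩ openConn 1 2) (listing.conf (J \ T)) +
                  ind ((openConn (0 : Fin 5) 1 : Set (BondConfig (Fin 5)))ᶜ ∩ (openConn 0 2 : Set (BondConfig (Fin 5)))ᶜ ∩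
                    (openConn 1 2 : Set (BondConfig (Fin 5)))ᶜ) (listing.conf (J \ T)))))) =
      ∑ e ∈ Finset.range 12, (cellCoeff I J e : ℝ) * q ^ e := by
  have hR : ∀ e ∈ Finset.range 12, (cellCoeff I J e : ℝ) * q ^ e =
      ∑ T ∈ (J \ I).powerset,
        ((if kOf (maskOf (I ∪ T)) + kOf (maskOf (J \ T)) = e then (sig0 (maskOf (I ∪ T)) (maskOf (J \ T)) : ℝ) else 0) +
          (if kOf (maskOf (I ∪ T)) + kOf (maskOf (J \ T)) + 1 = e then (sig1 (maskOf (I ∪ T)) (maskOf (J \ T)) : ℝ) else 0)) *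
          q ^ e := by
    intro e _
    rw [cellCoeff, Int.cast_sum, Finset.sum_mul]
    refine Finset.sum_congr rfl fun T _ => ?_
    push_cast
    rfl
  rw [Finset.sum_congr rfl hR, Finset.sum_comm]
  refine Finset.sum_congr rfl fun T _ => ?_
  have hn : kOf (maskOf (I ∪ T)) + kOf (maskOf (J \ T)) + 1 < 12 := by
    have h1 := kOf_maskOf_le (I ∪ T)
    have h2 := kOf_maskOf_le (J \ T)
    omega
  rw [pairTerm_eq, sum_range_ite_eq q _ _ hn]

/-- **`CellOK` ⇒ the fiber polynomial is nonnegative on `[0,1]`** (Bernstein criterion, degree 11). [folklore] -/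
theorem powersetSum_nonneg_of_cellOK {q : ℝ} (hq0 : 0 ≤ q) (hq1 : q ≤ 1) (I J : Finset (Fin 8)) (h : CellOK I J) :
    0 ≤ ∑ T ∈ (J \ I).powerset,
        q ^ (clusterCount (listing.conf (I ∪ T)) ∅ + clusterCount (listing.conf (J \ T)) ∅) *
          (ind ((openConn (0 : Fin 5) 1 : Set (BondConfig (Fin 5)))ᶜ ∩ openConn 1 2) (listing.conf (I ∪ T)) +
            (1 - q) * (ind (openConn (0 : Fin 5) 1 ∩ (openConn 0 2 : Set (BondConfig (Fin 5)))ᶜ) (listing.conf (I ∪ T)) *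
                ind ((openConn (0 : Fin 5) 1 : Set (BondConfig (Fin 5)))ᶜ ∩ openConn 0 2) (listing.conf (J \ T)) -
              ind (openConn (0 : Fin 5) 1 ∩ openConn 0 2) (listing.conf (I ∪ T)) *
                (ind ((openConn (0 : Fin 5) 1 : Set (BondConfig (Fin 5)))ᶜ ∩ openConn 1 2) (listing.conf (J \ T)) +
                  ind ((openConn (0 : Fin 5) 1 : Set (BondConfig (Fin 5)))ᶜ ∩ (openConn 0 2 : Set (BondConfig (Fin 5)))ᶜ ∩
                    (openConn 1 2 : Set (BondConfig (Fin 5)))ᶜ) (listing.conf (J \ T))))) := by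
  rw [powersetSum_eq_sum_cellCoeff]
  refine sum_mul_pow_nonneg_of_bernstein (d := 11) (a := fun e => (cellCoeff I J e : ℝ)) (fun k hk => ?_) hq0 hq1
  have hk' := h k (by omega)
  unfold bern at hk'
  have : ((∑ e ∈ Finset.range (k + 1), cellCoeff I J e * ((11 - e).choose (k - e) : ℤ) : ℤ) : ℝ) =
      ∑ e ∈ Finset.range (k + 1), (cellCoeff I J e : ℝ) * ((11 - e).choose (k - e) : ℝ) := by
    push_cast
    rfl
  rw [← this]
  exact_mod_cast hk'

/-! ### The bound at the hub triple `(0; 1, 2)` for weight vectors supported in `E₈` -/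

/-- **`K₅` at `(0; 1, 2)`, conditional on the cell certificate**: if `CellOK I J` for all `I ⊆ J ⊆ Fin 8`, then for every `0 < q ≤ 1` and
every weight vector `U` on `Fin 5` vanishing off the listed pairs `E₈` (in particular on `01`, `02` and the loops),
`HubCovBoundUnder (φ_{U,q}) q 0 1 2`. [cite: Grimmett2006, §3.9 eq. (3.94) (pp. 63–64)] [cite: Wagner2006, Conj. 5.3, Ex. 5.1–5.2 (p. 13)] -/
theorem hubCovBoundUnder_012_of_cellOK (hcells : ∀ I J : Finset (Fin 8), I ⊆ J → CellOK I J) {q : ℝ} (hq0 : 0 < q)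
    (hq1 : q ≤ 1) (U : Sym2 (Fin 5) → unitInterval) (hU : ∀ e, ((U e : unitInterval) : ℝ) ≠ 0 → e ∈ Set.range listing.edge) :
    HubCovBoundUnder (rcMeasureW U q ∅) q (0 : Fin 5) 1 2 :=
  RCEval.hubCovBoundUnder_of_listed listing_valid hq0 U hU 0 1 2 fun I J hIJ =>
    powersetSum_nonneg_of_cellOK hq0.le hq1 I J (hcells I J hIJ)

end K5

end FK

end Summit.CriticalPhenomena.PercolationContinuityZ3.Theorems
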